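import Literature.Computability.Cryptography.CsidhActionProofs
import Literature.NumberTheory.EllipticCurves.FrobeniusManinProofs
import Literature.NumberTheory.EllipticCurves.IsogenyHomProofs
import Literature.NumberTheory.EllipticCurves.IsogenyMulProofs
import Literature.NumberTheory.EllipticCurves.FrobeniusEndomorphism
import HarnessLib

/-!
# The CSIDH class-group action: kernels, the Frobenius `π` with `π² = -p`, and `[m] + π`

Sibling *proofs* file (theorems only, D-0014/D-0026) of
`Literature.Computability.Cryptography.CsidhAction`, working towards the named fact
`csidh_classGroupAction` (Castryck–Lange–Martindale–Panny–Renes, *CSIDH*, ASIACRYPT 2018, §3).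
Tools for the ideal-theoretic bookkeeping of the action (`E[𝔞]`, `π`, `ℤ[π] = ℤ[√-p]`):

* `exists_isogeny_deg_eq_one_of_ker_eq_ker` (**CSIDH Lemma 6, uniqueness, general form**): two
  `𝔽_p`-isogenies out of a valid `E_A` with the *same* kernel on `𝔽̄_p`-points (the kernel being
  that of a separable quotient, e.g. `E_A[𝔞_f]`) have codomains related by an `𝔽_p`-isogeny of
  degree one — separable or not ("the isogeny `φ_𝔞` and codomain `E/𝔞` are … unique up to
  `𝔽_p`-isomorphism (by Lemma 6)");
* `frob_smul_frob_smul` (**`π² = -p` on `E_A(𝔽̄_p)`** for valid `A`): the Frobenius of a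
  supersingular `E_A` (`#E_A(𝔽_p) = p + 1`, trace `0`) satisfies `π² + p = 0` pointwise (the
  tree's `frobenius_sq_sub_trace_smul_add_card_smul`, Manin's elementary proof of
  *AEC* V.2.3.1(b)); CSIDH §4: "The Frobenius endomorphism `π` satisfies `π² = -p`";
* `exists_isogeny_zsmul_add_frob` (**`[m] + π ∈ End_p(E_A)` as an isogeny**, `m ≠ 0`): the sum
  of the isogenies `[m]` and `π` is an `𝔽_p`-isogeny `E_A → E_A` acting by `P ↦ mP + πP` (sums of
  isogenies are isogenies or zero, the tree's `Isogeny.add_toAddMonoidHom_eq_zero_or_exists`; it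
  is not zero since `π = -m` would give `[m² + p] = 0`);
* `exists_quotient_idealKernel'`: the separable quotient by `E_A[𝔞_f]` for any form with `a ≠ 0`
  (not necessarily reduced).

## References

* [CastryckEtAl2018] W. Castryck, T. Lange, C. Martindale, L. Panny, J. Renes, *CSIDH*,
  ASIACRYPT 2018, §3 Lemma 6 and the class-group action, §4.
* [SilvermanAEC2009] J. H. Silverman, *The Arithmetic of Elliptic Curves*, 2nd ed.,
  Cor. II.2.12, Cor. III.4.11, Thm. V.2.3.1(b).

## Design

`noncomputable section`, `open scoped Classical`; theorems only, no definitions, no new named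
facts.
-/

noncomputable section

open scoped Classical

namespace Literature.Computability.Cryptography.Csidh

open Literature.NumberTheory.QuadraticFields.Quadratic
open Literature.NumberTheory.QuadraticFields.Quadratic.BinQF
open WeierstrassCurve

variable {p : ℕ} [Fact p.Prime]

/-! ### Lemma 6, uniqueness, for arbitrary isogenies with a common kernel -/

/-- **CSIDH Lemma 6 (uniqueness of the codomain), general form.** Let `E` be an elliptic curve
over `𝔽_p` and `g : E → E'` a separable `𝔽_p`-isogeny (`deg g = #ker g`). If two `𝔽_p`-isogenies
`φ₁ : E → E₁`, `φ₂ : E → E₂` to elliptic curves have kernel `ker g` on `𝔽̄_p`-points, then there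
is an `𝔽_p`-isogeny `E₁ → E₂` of degree one. (As in `exists_isogeny_deg_eq_one_of_isActResult`:
`φᵢ = λᵢ ∘ g` with `ker λᵢ = O` by *AEC* Cor. III.4.11; `λ₁ = μ₁ ∘ Frob` with `deg μ₁ = 1` by
Cor. II.2.12 and `E'^{(p^r)} = E'`; the dual `μ̂₁` inverts `μ₁` on points, and `λ₂ ∘ μ̂₁` has
trivial kernel.) [cite: CastryckEtAl2018, §3 Lemma 6] -/
theorem exists_isogeny_deg_eq_one_of_ker_eq_ker {W W' W₁ W₂ : WeierstrassCurve (ZMod p)}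
    [W.IsElliptic] [W'.IsElliptic] [W₁.IsElliptic] [W₂.IsElliptic]
    (g : W.Isogeny W') (hgdeg : g.deg = Nat.card g.toAddMonoidHom.ker)
    (φ₁ : W.Isogeny W₁) (φ₂ : W.Isogeny W₂)
    (h₁ : φ₁.toAddMonoidHom.ker = g.toAddMonoidHom.ker)
    (h₂ : φ₂.toAddMonoidHom.ker = g.toAddMonoidHom.ker) :
    ∃ mu : W₁.Isogeny W₂, mu.deg = 1 := by
  haveI : ExpChar (ZMod p) p := ExpChar.prime Fact.out
  obtain ⟨lam₁, hlam₁, hker₁⟩ := exists_eq_comp_of_ker_eq g hgdeg φ₁ h₁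
  obtain ⟨lam₂, hlam₂, hker₂⟩ := exists_eq_comp_of_ker_eq g hgdeg φ₂ h₂
  -- `λ₁ = μ₁ ∘ Frob_{p^r}` with `μ₁ : E'^{(p^r)} = E' → E₁` separable of degree one
  obtain ⟨r, mu₁, -, -, hdeg₁, hkerμ₁⟩ := lam₁.exists_eq_comp_frobeniusTwistIsogeny p
  have hk1 : Nat.card lam₁.toAddMonoidHom.ker = 1 := by rw [hker₁, AddSubgroup.card_bot]
  rw [hk1] at hdeg₁ hkerμ₁
  obtain ⟨nu, hnu, -⟩ := mu₁.exists_dual_of_deg_le_card_ker (hdeg₁.trans hkerμ₁.symm).le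
  rw [hkerμ₁] at hnu
  simp only [one_nsmul] at hnu
  have hnu_inj : Function.Injective nu := injective_of_leftInverse_of_surjective hnu mu₁.surjective
  have htw : W'.frobeniusTwist p r = W' := frobeniusTwist_eq_self W' r
  obtain ⟨lam₂', hlam₂'⟩ : ∃ lam₂' : (W'.frobeniusTwist p r).Isogeny W₂,
      lam₂'.toAddMonoidHom.ker = ⊥ := by
    suffices h : ∀ (X : WeierstrassCurve (ZMod p)), X = W' →
        ∃ lam₂' : X.Isogeny W₂, lam₂'.toAddMonoidHom.ker = ⊥ from h _ htw
    rintro X rfl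
    exact ⟨lam₂, hker₂⟩
  have hker : (lam₂'.comp nu).toAddMonoidHom.ker = ⊥ := by
    refine (AddSubgroup.eq_bot_iff_forall _).2 fun Q hQ ↦ ?_
    rw [AddMonoidHom.mem_ker, Isogeny.coe_toAddMonoidHom, Isogeny.comp_apply] at hQ
    have hQ' : nu Q ∈ lam₂'.toAddMonoidHom.ker := by
      rw [AddMonoidHom.mem_ker]
      exact hQ
    rw [hlam₂', AddSubgroup.mem_bot] at hQ'
    exact hnu_inj (hQ'.trans (map_zero nu).symm)
  exact exists_isogeny_deg_eq_one_of_ker_eq_bot (lam₂'.comp nu) hker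

/-! ### The separable quotient for any form with `a ≠ 0` -/

/-- **CSIDH Lemma 6 (existence) for `G = E_A[𝔞_f]`, any form with `a ≠ 0`** (not necessarily a
label). [cite: CastryckEtAl2018, §3 Lemma 6] -/
theorem exists_quotient_idealKernel' (hp8 : p % 8 = 3) {f : BinQF} (hf : f.a ≠ 0)
    {A : ZMod p} (hA : IsCoeff p A) :
    ∃ (W' : WeierstrassCurve (ZMod p)) (_ : W'.IsElliptic) (g : (curve p A).Isogeny W'),
      g.toAddMonoidHom.ker = idealKernel p f A ∧ g.deg = Nat.card (idealKernel p f A) := by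
  haveI := isElliptic_of_isCoeff hp8 hA
  haveI : PerfectField (ZMod p) := PerfectField.ofFinite
  exact exists_separable_isogeny_ker_eq_holds (curve p A) (idealKernel p f A)
    (finite_idealKernel hf A) (fun σ _ hP ↦ smul_mem_idealKernel σ hP)

/-! ### `π² = -p` on a valid `E_A` -/

/-- The Frobenius `frob p` is the `#𝔽_p`-power map on `𝔽̄_p`. [folklore] -/
theorem frob_smul_eq_pow_card (x : AlgebraicClosure (ZMod p)) : frob p • x = x ^ Nat.card (ZMod p) := by
  haveI : NeZero p := ⟨(Fact.out : p.Prime).ne_zero⟩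
  rw [frob_smul, Nat.card_eq_fintype_card, ZMod.card]

/-- **`π² = -p` on `E_A(𝔽̄_p)` for a valid `A`**: `π(πT) + pT = O` (trace `a = p + 1 - #E_A(𝔽_p)
= 0`, and `π² - aπ + p = 0` pointwise, the tree's `frobenius_sq_sub_trace_smul_add_card_smul`).
CSIDH §4: "The Frobenius endomorphism `π` satisfies `π² = -p`".
[cite: CastryckEtAl2018, §4 (Parameters)] [cite: SilvermanAEC2009, Thm. V.2.3.1(b)] -/
theorem frob_smul_frob_smul (hp8 : p % 8 = 3) {A : ZMod p} (hA : IsCoeff p A)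
    (T : (curve p A).geomPoints) : frob p • (frob p • T) = -((p : ℤ) • T) := by
  haveI := isElliptic_of_isCoeff hp8 hA
  haveI : NeZero p := ⟨(Fact.out : p.Prime).ne_zero⟩
  have h := (curve p A).frobenius_sq_sub_trace_smul_add_card_smul (σ := frob p)
    (fun x ↦ frob_smul_eq_pow_card x) T
  have htr : Literature.NumberTheory.EllipticCurves.HasseManin.tr (curve p A) = 0 := by
    rw [Literature.NumberTheory.EllipticCurves.HasseManin.tr, hA.2, ZMod.card]
    push_cast
    ring
  rw [htr, zero_smul, sub_zero, ZMod.card] at h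
  exact eq_neg_of_add_eq_zero_left h

/-- `π` commutes with integer multiples (it is additive). [folklore] -/
theorem frob_smul_zsmul {A : ZMod p} (m : ℤ) (T : (curve p A).geomPoints) :
    frob p • (m • T) = m • (frob p • T) :=
  smul_comm _ _ _

/-! ### The endomorphisms `[m] + π` -/

/-- **`[m] + π` is an `𝔽_p`-isogeny `E_A → E_A`** for a valid `A` and `m ≠ 0`: the sum of the
isogenies `[m]` (*AEC* III.4.1) and the Frobenius `π` is an isogeny or zero (the tree's
`Isogeny.add_toAddMonoidHom_eq_zero_or_exists`, *AEC* III.§4), and it is not zero: `π = -m` on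
`E_A(𝔽̄_p)` would give `π² = m²`, i.e. `[m² + p] = 0`, whereas `E_A[m² + p]` is finite and
`E_A(𝔽̄_p)` is not. These are the elements `m + π ∈ ℤ[π] = End_p(E_A)` of CSIDH §3–4 (e.g.
`π - 1`, `π + 1`, `-b/2 + √-p`). [cite: CastryckEtAl2018, §3 (class-group action) and §4] -/
theorem exists_isogeny_zsmul_add_frob (hp8 : p % 8 = 3) {A : ZMod p} (hA : IsCoeff p A) {m : ℤ}
    (hm : m ≠ 0) :
    ∃ τ : (curve p A).Isogeny (curve p A), ∀ T, τ T = m • T + frob p • T := by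
  haveI := isElliptic_of_isCoeff hp8 hA
  haveI : NeZero p := ⟨(Fact.out : p.Prime).ne_zero⟩
  set φm := Isogeny.zsmul (curve p A) m hm with hφm
  set π := (curve p A).frobeniusIsogeny (σ := frob p) (fun x ↦ frob_smul_eq_pow_card x) with hπ
  rcases φm.add_toAddMonoidHom_eq_zero_or_exists π with h0 | ⟨τ, hτ⟩
  · -- `π = -m`: then `(m² + p) T = 0` for all `T`
    exfalso
    have hπm : ∀ T : (curve p A).geomPoints, frob p • T = -(m • T) := fun T ↦ by
      have := DFunLike.congr_fun h0 T
      rw [AddMonoidHom.add_apply, AddMonoidHom.zero_apply, Isogeny.coe_toAddMonoidHom,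
        Isogeny.coe_toAddMonoidHom, hφm, Isogeny.zsmul_apply, hπ, frobeniusIsogeny_apply] at this
      exact eq_neg_of_add_eq_zero_right this
    have hall : ∀ T : (curve p A).geomPoints, (m ^ 2 + p) • T = 0 := fun T ↦ by
      have h2 := frob_smul_frob_smul hp8 hA T
      rw [hπm T, smul_neg, hπm, neg_neg, smul_smul] at h2
      rw [add_zsmul, sq, h2, neg_add_cancel]
    have hN : (m ^ 2 + p : ℤ) ≠ 0 := by positivity
    haveI : Finite (geomTorsion (curve p A) (m ^ 2 + p)) :=
      finite_torsionPoints_holds (curve p A) (AlgebraicClosure (ZMod p)) hN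
    have htop : (geomTorsion (curve p A) (m ^ 2 + p) : Set (curve p A).geomPoints) = Set.univ := by
      ext T
      simp only [SetLike.mem_coe, Set.mem_univ, iff_true]
      exact (Submodule.mem_torsionBy_iff _ _).2 (hall T)
    have hfin : (Set.univ : Set (curve p A).geomPoints).Finite := htop ▸ Set.toFinite _
    exact Set.infinite_univ (α := (curve p A).geomPoints) hfin
  · refine ⟨τ, fun T ↦ ?_⟩
    have := DFunLike.congr_fun hτ T
    rw [AddMonoidHom.add_apply, Isogeny.coe_toAddMonoidHom, Isogeny.coe_toAddMonoidHom,
      Isogeny.coe_toAddMonoidHom, hφm, Isogeny.zsmul_apply, hπ, frobeniusIsogeny_apply] at this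
    exact this

/-- **`(m' + π)(m + π) = (mm' - p) + (m + m')π` on points**; in particular for `m' = -m`,
`(-m + π)(m + π) = -(m² + p)`: the norm form of `ℤ[√-p]` (CSIDH §3: `N(a) = a ā`).
[cite: CastryckEtAl2018, §3 (the ideal-class group: norm)] -/
theorem zsmul_add_frob_comp (hp8 : p % 8 = 3) {A : ZMod p} (hA : IsCoeff p A) (m m' : ℤ)
    (T : (curve p A).geomPoints) :
    m' • (m • T + frob p • T) + frob p • (m • T + frob p • T) =
      (m * m' - p) • T + (m + m') • (frob p • T) := by
  rw [smul_add (frob p), frob_smul_frob_smul hp8 hA, frob_smul_zsmul]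
  generalize frob p • T = X
  module

end Literature.Computability.Cryptography.Csidh
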